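import Literature.AlgebraicGeometry.Motives.Correspondences
import Literature.AlgebraicGeometry.Motives.WeilCohomologyProofs
import Literature.AlgebraicGeometry.Motives.MotivatedCyclesProofs
import HarnessLib

/-!
# Grothendieck's form `A(X)` of the standard conjecture of Lefschetz type, and `B(X) ⇒ A(X)`

Source: A. Grothendieck, *Standard conjectures on algebraic cycles*, in: Algebraic Geometry
(Internat. Colloq., Tata Inst. Fund. Res., Bombay 1968), Oxford Univ. Press (1969), 193–199
[Grothendieck1968], §3 "The conjecture 1 (of Lefschetz type)", pp. 195–197 (read from the
scanned original).

Grothendieck (p. 196) states the conjecture of Lefschetz type first in the form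

* `A(X)`: for `X` smooth projective of dimension `n` and `ξ ∈ H²(X)` the class of a hyperplane
  section, (a) `∪ ξⁿ⁻ⁱ : Hⁱ(X) → H²ⁿ⁻ⁱ(X)` (`i ≤ n`) "is always an isomorphism (the mild form)";
  (b) "if `i = 2j`, it induces an isomorphism (or equivalently, an epimorphism)
  `Cʲ(X) → Cⁿ⁻ʲ(X)`", where `Cⁱ(X) ⊆ H²ⁱ(X)` is the image of the cycle map
  `cl : 𝒵ⁱ(X) ⊗_ℤ ℚ → H²ⁱ(X)` (p. 194), i.e. the group `W.ratAlgebraicClasses X i` of the tree;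

and then in the "equivalent formulation" `B(X)`: "the `Λ`-operation of Hodge theory is
algebraic", noting (p. 196) "`B(X) ⇒ A(X)`, since the algebraicity of `Λ` implies that of `Λⁿ⁻ⁱ`,
and `Λⁿ⁻ⁱ` provides an inverse to `∪ ξⁿ⁻ⁱ : Hⁱ(X) → H²ⁿ⁻ⁱ(X)`", and "`A(X × X) ⇒ B(X)`".

The tree vendors `B(X)` in Kleiman's `θ`-form
`Literature.AlgebraicGeometry.Motives.WeilCohomology.StandardConjectureB` (for each `i ≤ n` the
inverse `θ` of `Lⁿ⁻ⁱ` exists and is induced by an algebraic correspondence with `ℚ`-coefficients;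
file `Correspondences`). This file adds Grothendieck's form `A(X)` as a definition
(`WeilCohomology.StandardConjectureA`) and **proves** the printed implication `B(X) ⇒ A(X)`
from the `θ`-form (`WeilCohomology.StandardConjectureB.standardConjectureA`), for an arbitrary
Weil cohomology theory `W` in the sense of the tree: (a) is the two-sided invertibility of `Lⁿ⁻ⁱ`
(`StandardConjectureB.bijective_lefschetzPow`); for (b), `Lⁿ⁻²ʲ` maps `Cʲ(X)` into `Cⁿ⁻ʲ(X)`
because a hyperplane class and its powers are rational algebraic classes, it is injective by (a),
and it is surjective because the *algebraic* inverse `θ` maps `Cⁿ⁻ʲ(X)` into `Cʲ(X)`.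

## Status of the conjecture (no discharge)

`B(X)` / `A(X)` is posed by Grothendieck as a **conjecture** (p. 196: "It is expected (and has
been established by Lefschetz over the complex field by transcendental methods) that this is an
isomorphism for all characteristics"; p. 196–197: `B(X)` "holds for projective space", for "smooth
varieties which are complete intersections in some projective space", "for Grassmannians, and for
abelian varieties (Liebermann)"; p. 198: "Alongside the problem of resolution of singularities,
the proof of the standard conjectures seems to me to be the most urgent task in algebraic
geometry"). It is recorded in the tree as the `Prop`-valued definitions `W.StandardConjectureB`,
`W.LefschetzStandardConjecture` (hodge.S02), which accordingly have **no** `_holds` theorem; this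
file does not (and cannot) discharge them, and the new `W.StandardConjectureA` carries the same
`OPEN CONJECTURE — … [status: open]` docstring marker as those siblings (an open statement, not
literature debt). What it proves are the formal consequences printed in the source, plus the
degenerate case `dim X = 0` of `B(X)` as a sanity check of the bookkeeping
(`standardConjectureB_of_isSmoothProjective_zero`).

## Main statements

(`W : WeilCohomology k K`; namespace `Literature.AlgebraicGeometry.Motives.WeilCohomology`.)

* `W.StandardConjectureA n X η` : Grothendieck's form `A(X)` ((a) and (b)) — definition, marked
  `OPEN CONJECTURE — … [status: open]`.
* `StandardConjectureB.standardConjectureA` : `B(X) ⇒ A(X)` (Grothendieck 1968, p. 196) — proved.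
* `LefschetzStandardConjecture.standardConjectureA` : the same for the universal-in-`X` form.
* auxiliary facts reused from sibling proof files: `L⁰ = id`
  (`WeilCohomology.lefschetzPow_zero_apply`, `WeilCohomologyProofs`), `η ∈ A¹(X)_ℚ` and
  `ηʳ⁺¹ ∈ Aʳ⁺¹(X)_ℚ` (`WeilCohomology.mem_ratAlgebraicClasses_of_isHyperplaneClass`,
  `WeilCohomology.pow_succ_mem_ratAlgebraicClasses`, `MotivatedCyclesProofs`).
* `standardConjectureB_of_isSmoothProjective_zero` : `B(X)` for `X` of dimension `0` — proved.

## Known-theorem policy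

As in `Correspondences`: every theorem carries a "Depends only on:" paragraph naming the fields of
`Literature.AlgebraicGeometry.Motives.WeilCohomology` it uses; everything here is formal in those
axioms together with the discharged fact `isSmoothProjective_projectiveSpace_holds` (`ℙᴺ_k` is
smooth projective, needed to pull rational algebraic classes back along a projective embedding).

## Design choices

* `Cʲ(X)` is `W.ratAlgebraicClasses X j` (the divisible hull of the lattice of algebraic classes,
  which is the image of `𝒵ʲ(X) ⊗ ℚ` since `K` has characteristic zero), coerced to a `Set` so that
  "(∗) induces an isomorphism `Cʲ(X) → Cⁿ⁻ʲ(X)`" is `Set.BijOn` (maps into, injective on,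
  surjective onto); degrees are cast-free (`2p + r = n`, `2p + 2r = 2q`) as in the rest of the
  topic.
* Grothendieck works over an algebraically closed field with `ℓ`-adic cohomology; as for `B(X)` in
  `Correspondences`, the statement is rendered for an arbitrary `W : WeilCohomology k K`.
* Mathlib has none of this vocabulary (see `Correspondences`); only `Set.BijOn`,
  `Function.Injective.injOn` and `LinearMap` API are used.

## References

* A. Grothendieck, *Standard conjectures on algebraic cycles*, Algebraic Geometry (Bombay 1968),
  Oxford Univ. Press (1969), 193–199 (Zbl 0201.23301), §3, pp. 195–197. [Grothendieck1968]
* S. Kleiman, *Algebraic cycles and the Weil conjectures*, in: Dix exposés sur la cohomologie des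
  schémas, North-Holland (1968), 359–386, §2. [Kleiman1968]
* S. Kleiman, *The standard conjectures*, in: Motives (Seattle 1991), Proc. Sympos. Pure Math. 55
  Part 1 (1994), 3–20, Thm 4-1. [Kleiman1994]
-/

universe u v

open CategoryTheory AlgebraicGeometry MonoidalCategory CartesianMonoidalCategory

noncomputable section

namespace Literature.AlgebraicGeometry.Motives

namespace WeilCohomology

variable {k : Type u} [Field k] {K : Type v} [Field K] [CharZero K] (W : WeilCohomology k K)

/-! ## Grothendieck's form `A(X)` -/

section Defs

variable (n : ℕ) (X : SchemeOver k)

/-- OPEN CONJECTURE — **standard conjecture of Lefschetz type, Grothendieck's form `A(X)`**, posed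
by Grothendieck (Bombay 1968, §3 "The conjecture 1 (of Lefschetz type)", p. 196) [status: open]:
for `X` smooth projective of dimension `n` with hyperplane class `η` (Grothendieck's `ξ`),
(a) *(the mild form)*
`Lʳ = (· ∪ ηʳ) : Hⁱ(X) → H²ⁿ⁻ⁱ(X)`, `r = n - i`, is an isomorphism for every `i ≤ n` (written
`i + r = n`, `i + 2r = j`), and (b) for `i = 2p` it induces an isomorphism `Cᵖ(X) → Cⁿ⁻ᵖ(X)` of
the groups of rational algebraic classes (`Cᵖ(X) = W.ratAlgebraicClasses X p`, the image of
`𝒵ᵖ(X) ⊗ ℚ` in `H²ᵖ(X)`; written `2p + r = n`, `2p + 2r = 2q`, so `q = n - p`): `Lʳ` maps `Cᵖ(X)`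
into `C^q(X)`, injectively, and onto ("or equivalently, an epimorphism": injectivity is automatic
from (a)). Clause (a) is exactly the `(n, X, η)`-instance of the hard Lefschetz property
`W.HasHardLefschetz` (file `WeilCohomology`; there is no separate per-`X` hard-Lefschetz
definition).

Status: open — Grothendieck (p. 196) shows `A(X)` is equivalent to `B(X)` (`B(X) ⇒ A(X)`, proved
below as `StandardConjectureB.standardConjectureA`; `A(X × X) ⇒ B(X)`), so `A` is open exactly as
`StandardConjectureB` is ("still unknown even in the complex case"; known for projective spaces,
complete intersections, Grassmannians, abelian varieties — Grothendieck 1968 pp. 196–197 — and for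
curves and surfaces, see `StandardConjectureB`); clause (a) alone is a theorem for the classical
theories (hard Lefschetz) but not for a general `W`. A per-`(X, η)` predicate, like its siblings in
`Correspondences`; no `_holds` theorem can exist short of settling the conjecture.
[cite: Grothendieck1968, §3 p. 196 (A(X))] -/
def StandardConjectureA (η : W.obj X 2) : Prop :=
  (∀ (i r j : ℕ), i + r = n → ∀ h : i + 2 * r = j,
      Function.Bijective (W.lefschetzPow X η r i j h)) ∧
    ∀ (p r q : ℕ), 2 * p + r = n → ∀ h : 2 * p + 2 * r = 2 * q,
      Set.BijOn (W.lefschetzPow X η r (2 * p) (2 * q) h)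
        (W.ratAlgebraicClasses X p : Set (W.obj X (2 * p))) (W.ratAlgebraicClasses X q)

end Defs

variable {W}
variable {n : ℕ} {X : SchemeOver k} {η : W.obj X 2}

/-! ## `B(X) ⇒ A(X)` -/

/-- **`B(X) ⇒ A(X)`** (Grothendieck 1968 §3, p. 196: "`B(X) ⇒ A(X)`, since the algebraicity of
`Λ` implies that of `Λⁿ⁻ⁱ`, and `Λⁿ⁻ⁱ` provides an inverse to `∪ ξⁿ⁻ⁱ : Hⁱ(X) → H²ⁿ⁻ⁱ(X)`"). For
`X` smooth projective of dimension `n` with hyperplane class `η`, the `θ`-form of `B(X)`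
(`W.StandardConjectureB n X η`: the inverse `θ` of each `Lⁿ⁻ⁱ` exists and is algebraic) implies
Grothendieck's `A(X)`: (a) `Lⁿ⁻ⁱ : Hⁱ(X) → H²ⁿ⁻ⁱ(X)` is bijective
(`StandardConjectureB.bijective_lefschetzPow`); (b) `Lʳ = (· ∪ ηʳ)` maps `Cᵖ(X)` into `C^q(X)`
(`ηʳ` is a rational algebraic class and cup products preserve these), is injective on it by (a),
and is onto: for `y ∈ C^q(X)`, `x = θ y` lies in `Cᵖ(X)` because `θ` is induced by a rational
algebraic correspondence, and `Lʳ x = Lʳ θ y = y`.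

Depends only on: `cup_comm`, `one_cup` (`L⁰ = id`, `WeilCohomology.lefschetzPow_zero_apply`),
`cup_mem_ratAlgebraicClasses`, `pullback_ratAlgebraicClasses_le` with
`isSmoothProjective_projectiveSpace_holds` (`ηʳ` is rational algebraic), and
`map_ratAlgebraicClasses_of_isInducedBy` (algebraic correspondences preserve rational algebraic
classes). No hard Lefschetz hypothesis (the `θ`-form contains it).
[cite: Grothendieck1968, §3 p. 196 (B(X) ⇒ A(X))] -/
theorem StandardConjectureB.standardConjectureA (hX : IsSmoothProjective n X)
    (hη : W.IsHyperplaneClass X η) (hB : W.StandardConjectureB n X η) :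
    W.StandardConjectureA n X η := by
  refine ⟨fun i r j h₁ h₂ ↦ hB.bijective_lefschetzPow h₁ h₂, fun p r q hn h ↦ ⟨?_, ?_, ?_⟩⟩
  · -- `Lʳ` maps `Cᵖ(X)` into `C^q(X)`
    intro x hx
    rcases r with _ | r
    · obtain rfl : q = p := by omega
      rw [SetLike.mem_coe, W.lefschetzPow_zero_apply hX η h x]
      exact hx
    · exact W.cup_mem_ratAlgebraicClasses hX (show p + (r + 1) = q by omega) x _ hx
        (W.pow_succ_mem_ratAlgebraicClasses hX
          (W.mem_ratAlgebraicClasses_of_isHyperplaneClass hX hη) r)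
  · -- injective on `Cᵖ(X)`, by (a)
    exact (hB.bijective_lefschetzPow hn h).1.injOn
  · -- onto `C^q(X)`: the algebraic inverse `θ` maps `C^q(X)` into `Cᵖ(X)`
    intro y hy
    obtain ⟨θ, ⟨-, -, hLθ⟩, u, hu, -⟩ := hB (2 * p) r (2 * q) hn h
    have hθ := hu (2 * q) (2 * p) (2 * p) (2 * q) (by omega) (by omega) (by omega)
    rw [PreWeilCohomology.GradedOp.ofLinearMap_apply_same] at hθ
    refine ⟨θ y, W.map_ratAlgebraicClasses_of_isInducedBy hX hX _ θ _ _ (u (2 * p)).2 hθ y hy, ?_⟩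
    show (W.lefschetzPow X η r (2 * p) (2 * q) h ∘ₗ θ) y = y
    rw [hLθ, LinearMap.id_apply]

/-- `B` for `W` (all smooth projective `X`, all hyperplane classes) implies Grothendieck's form
`A(X)` for all such `(X, η)` (Grothendieck 1968 §3, p. 196, `B ⇒ A`).
[cite: Grothendieck1968, §3 p. 196 (B(X) ⇒ A(X))] -/
theorem LefschetzStandardConjecture.standardConjectureA (h : W.LefschetzStandardConjecture)
    (hX : IsSmoothProjective n X) (hη : W.IsHyperplaneClass X η) : W.StandardConjectureA n X η :=
  (h hX η hη).standardConjectureA hX hη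

/-! ## Sanity: `B(X)` in dimension `0` -/

/-- **`B(X)` holds for `X` of dimension `0`** (sanity check of the `θ`-form; compare
Grothendieck 1968 p. 196, "since it holds for projective space": `ℙ⁰` is the case at hand): the
only instance is `i = 0`, `r = 0`, where `L⁰ = id : H⁰(X) → H⁰(X)` has the inverse `θ = id`,
which is induced by the (rational algebraic) class of the diagonal.

Depends only on: `cup_comm`, `one_cup` (`L⁰ = id`, `WeilCohomology.lefschetzPow_zero_apply`) and
`exists_isInducedBy_id` (the diagonal induces the identity). [folklore] -/
theorem standardConjectureB_of_isSmoothProjective_zero (hX : IsSmoothProjective 0 X)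
    (η : W.obj X 2) : W.StandardConjectureB 0 X η := by
  intro i r j h₁ h₂
  obtain rfl : i = 0 := by omega
  obtain rfl : r = 0 := by omega
  obtain rfl : j = 0 := by omega
  have hL : W.lefschetzPow X η 0 0 0 h₂ = LinearMap.id :=
    LinearMap.ext fun x ↦ W.lefschetzPow_zero_apply hX η h₂ x
  refine ⟨LinearMap.id, ⟨rfl, ?_, ?_⟩, ?_⟩
  · rw [hL, LinearMap.id_comp]
  · rw [hL, LinearMap.id_comp]
  · obtain ⟨u, hu, hind⟩ := W.exists_isInducedBy_id hX
    refine ⟨(fun c ↦ match c with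
        | 0 => ⟨u, hu⟩
        | _ + 1 => 0), ?_, ?_⟩
    · intro i j c j' hj hm _
      obtain rfl : c = 0 := by omega
      obtain rfl : i = 0 := by omega
      obtain rfl : j' = 0 := by omega
      obtain rfl : j = 0 := by omega
      rw [PreWeilCohomology.GradedOp.ofLinearMap_apply_same]
      exact hind 0 0 hj
    · intro i j hne
      exact PreWeilCohomology.GradedOp.ofLinearMap_apply_of_ne _ fun ⟨hi, hj⟩ ↦ hne ⟨0, by omega⟩

end WeilCohomology

end Literature.AlgebraicGeometry.Motives

end
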